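import Literature.AnabelianGeometry.SemiGraphs.TemperedVerticialDistinct
import Literature.AnabelianGeometry.SemiGraphs.TemperedDecompositionSingleVertex
import Literature.AnabelianGeometry.SemiGraphs.TemperedCoveringsProofs
import Literature.AlgebraicGeometry.Frobenioids.QuasiTemperoidConnected
import HarnessLib

/-!
# A finite tempered covering yields a finite quotient of `π₁^temp(𝒢)` separating edge-like from verticial subgroups
# ([SemiAnbd] §3: Prop. 3.6 (iii), Thm. 3.7 (i), (iii))

Mochizuki, *Semi-graphs of anabelioids*, Publ. RIMS **42** (2006), §3: p. 33 (`B^temp(Π)`: countable discrete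
sets with continuous `Π`-action), Prop. 3.6 (iii) p. 38 ("The full embedding `B(G) ↪ B^temp(G)` induces an
injection `π₁^temp(G) ↪ π̂₁(G)`" — the finite objects of `B^temp(G)` give the finite quotients of `π₁^temp(G)`),
Thm. 3.7 (i) p. 40 ("a natural continuous, injective outer homomorphism `π̂₁(G_v) ↪ π₁^temp(G)` … the verticial
subgroups"), Thm. 3.7 (iii) p. 41 ("images of '`π̂₁(G_e)`'s" — the edge-like subgroups)
[cite: MochizukiSemiAnbd2006, Prop 3.6(iii) p.38] [cite: MochizukiSemiAnbd2006, Thm 3.7(i) p.40].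

PROOF-ONLY file (abc-iut cell, layer L3 [SemiAnbd], seat abc-iut-L3-t11 gen 14, self-named supply row
«SEP-QUOTIENT@COVERING»; 0 definitions · 0 instances · 0 notation · 0 `Prop` facts).  In the tree a tempered
fundamental group is a CHART `c : TemperedPiChart 𝒢` (`c.equiv : B^temp(𝒢) ≌ B^temp(c.G)`, abc-iut-L3-t2's
`TemperedCoverings.lean`); the verticial / edge-like subgroups are the ranges of the continuous `ψ : Π_v → c.G` /
`ψ : Π_e → c.G` whose pull-back functor is the restriction `S ↦ S_v` / `S ↦ S_e` read through the chart
(`verticialSubgroups`, `edgeLikeSubgroups`, `IsVerticialHom`, `IsEdgeHom`).  WHAT IS PROVED HERE, for ANY chart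
(no group "on the nose" is needed):

* `BTemp.exists_openNormalSubgroup_forall_ρ_eq_iff` — a FINITE object `X` of `B^temp(Π)` (`Π` any topological group)
  has an open normal finite-index KERNEL `U_X ⊴ Π`: `g ∈ U_X ⟺ g` fixes `X` pointwise (open: finite intersection
  of the open stabilisers of p. 33; finite index: `Π/U_X ↪ 𝔖(X)`);
* `IsEdgeHom.exists_equiv` — the edge twin of abc-iut-L3's `IsVerticialHom.exists_equiv`: an edge homomorphism
  `ψ : Π_e → c.G` identifies `S_e` with the chart image `c(S)` restricted along `ψ`, for every tempered covering
  `S` (Thm. 3.7 (iii) read in `B^temp(G)`);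
* **`TemperedPiChart.exists_openNormal_ker_chartImage`** — for a tempered covering `S` of `𝒢` with ONE finite
  vertex fibre `S_{v₀}` (at a vertex carrying a verticial homomorphism), the kernel `U_S ⊴ π₁^temp(𝒢)` of the
  chart image `c(S)` is open normal of finite index, and THROUGH the Thm. 3.7 identifications:
  `ψ_v(γ) ∈ U_S ⟺ γ` fixes `S_v` (every verticial `ψ_v`), `ψ_e(γ) ∈ U_S ⟺ γ` fixes `S_e` (every edge `ψ_e`);
* subgroup currency: **`exists_openNormal_of_covering`** (ONE `U` for all vertices and edges at once:
  `V ≤ U ⟺ Π_w` fixes `S_w` for `V ∈ verticialSubgroups c w`, `L ≤ U ⟺ Π_e` fixes `S_e` for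
  `L ∈ edgeLikeSubgroups c e`), **`exists_openNormal_separating_of_covering`** (`Π_v` fixes `S_v`, `Π_e` MOVES
  `S_e` ⇒ `∃ U` open normal finite-index with `T ≤ U`, `¬ L ≤ U` for every verticial `T` at `v` and edge-like
  `L` at `e`) and its twin `exists_openNormal_separating_decomp_singleVertex_of_covering` for the decomposition
  subgroups of the edgeless single-vertex sub-semi-graph `⟨{v}, ∅⟩` (abc-iut-L3-t6's
  `decompSubgroups_singleVertex_eq`, [IUTchI] §2 p. 44);
* **`openNormalSeparating_singleVertex_of_coverings`** — the tempered-level separation binder `hsep` of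
  abc-iut-w4-d070's `Literature.IUT.HodgeTheaters.StableCurveTemperedData.hatEdgeIncidence_of_openNormalSeparating`
  (p498282; consumed BY NAME only in this docstring, not imported) at `ℍ := ⟨{v}, ∅⟩`, DISCHARGED from
  covering data: for every edge `e` not abutting `v`, ONE tempered covering with `S_v` finite and fixed by `Π_v`
  and `S_e` moved by `Π_e`; **`openNormalSeparating_singleVertex_of_finiteCoverings`** — the same from ONE
  FINITE `S : CovObj 𝒢` per such edge under `Prop36Hypotheses` (finite objects are tempered,
  abc-iut-L3-t2's `FiniteIsTempered_holds`).

USE (count-neutral supply for the L5 row «COR23VI-HF-STRONG-NV»): at a carrier `𝒢` with `≥ 2` vertices and an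
open edge `e` far from `v`, the STRONG non-vacuity of the pro-`Σ̂` edge–subgraph incidence `hF` reduces to ONE
object of `B^temp(𝒢)` (a finite `CovObj`, tempered e.g. by `isTempered_of_isFinite_of_prop36`) that is trivial over
`v` and non-trivial over `e` — pure covering data over `Prop36Hypotheses`, at `𝒢.temperedPiChart h36` or any chart.

Honest scope: statements about the tree's own objects; nothing of [SemiAnbd] is strengthened; no side is taken on
[IUTchIII] Cor. 3.12; typed ≠ inhabited ≠ proved for any claim of the IUT series; nothing here asserts that abc
is proved or refuted.
-/

namespace Literature.AnabelianGeometry.SemiGraphs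

open CategoryTheory Topology
open Literature.AlgebraicGeometry.Frobenioids.QuasiTemperoid.BTempConnected
  (ρ_one_apply ρ_mul_apply ρ_inv_apply ρ_apply_inv)

universe u

/-! ### 1. The kernel of a finite object of `B^temp(Π)` -/

section BTempTools

variable {G : Type u} [Group G] [TopologicalSpace G]

/-- **A finite object of `B^temp(Π)` has an open normal finite-index kernel** ([SemiAnbd] §3 p. 33: the action on
a discrete set is continuous iff all stabilisers are open; Prop. 3.6 (iii) p. 38: finite objects ↔ finite
quotients): there is an open normal subgroup `U ⊴ Π` of finite index with `g ∈ U ⟺ g` acts trivially on `X`.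
[cite: MochizukiSemiAnbd2006, Prop 3.6(iii) p.38] -/
theorem BTemp.exists_openNormalSubgroup_forall_ρ_eq_iff (X : BTemp G) [Finite X.obj.V] :
    ∃ U : OpenNormalSubgroup G, U.toSubgroup.FiniteIndex ∧
      ∀ g : G, g ∈ U.toSubgroup ↔ ∀ x : X.obj.V, X.obj.ρ g x = x := by
  classical
  -- the permutation representation `σ : Π → 𝔖(X)`
  let σ : G →* Equiv.Perm X.obj.V :=
    { toFun := fun g =>
        { toFun := fun x => X.obj.ρ g x
          invFun := fun x => X.obj.ρ g⁻¹ x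
          left_inv := fun x => ρ_inv_apply X g x
          right_inv := fun x => ρ_apply_inv X g x }
      map_one' := by
        ext x
        exact ρ_one_apply X x
      map_mul' := fun g h => by
        ext x
        exact ρ_mul_apply X g h x }
  have hmem : ∀ g : G, g ∈ σ.ker ↔ ∀ x : X.obj.V, X.obj.ρ g x = x := fun g => by
    rw [MonoidHom.mem_ker, Equiv.ext_iff]
    rfl
  -- open: a finite intersection of open stabilisers
  have hopen : IsOpen (σ.ker : Set G) := by
    have hset : (σ.ker : Set G) = ⋂ x : X.obj.V, {g : G | X.obj.ρ g x = x} := by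
      ext g
      simp only [SetLike.mem_coe, Set.mem_iInter, Set.mem_setOf_eq]
      exact hmem g
    rw [hset]
    exact isOpen_iInter_of_finite fun x => X.property.2 x
  -- finite index: `Π / Ker σ ≅ range σ ⊆ 𝔖(X)` is finite
  haveI : Finite (Equiv.Perm X.obj.V) :=
    Finite.of_injective (fun e : Equiv.Perm X.obj.V => (e : X.obj.V → X.obj.V)) DFunLike.coe_injective
  haveI : Finite (G ⧸ σ.ker) := Finite.of_equiv σ.range (QuotientGroup.quotientKerEquivRange σ).toEquiv.symm
  refine ⟨⟨⟨σ.ker, hopen⟩, inferInstance⟩, Subgroup.finiteIndex_of_finite_quotient, fun g => hmem g⟩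

/-- Transport of pointwise triviality along an equivariant bijection (pure bookkeeping).
[cite: MochizukiSemiAnbd2006, §3 p.34] -/
theorem BTemp.forall_ρ_eq_iff_of_equiv {H : Type u} [Group H] [TopologicalSpace H]
    {X : BTemp G} {Y : BTemp H} (e : X.obj.V ≃ Y.obj.V) {g : G} {h : H}
    (he : ∀ x : X.obj.V, e (X.obj.ρ g x) = Y.obj.ρ h (e x)) :
    (∀ x : X.obj.V, X.obj.ρ g x = x) ↔ ∀ y : Y.obj.V, Y.obj.ρ h y = y := by
  constructor
  · intro hX y
    obtain ⟨x, rfl⟩ := e.surjective y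
    rw [← he, hX]
  · intro hY x
    apply e.injective
    rw [he, hY]

end BTempTools

namespace ProfiniteSemiGraph

variable {𝒢 : ProfiniteSemiGraph.{u}}

/-! ### 2. Thm. 3.7 (iii) read in `B^temp(G)`: the edge twin of `IsVerticialHom.exists_equiv` -/

/-- An edge homomorphism `ψ : Π_e → π₁^temp(G)` identifies, for every tempered covering `S`, the `Π_e`-set `S_e`
with the chart image of `S` restricted along `ψ` (the defining isomorphism `B^temp(G) → G_e^⊤ ≅ B^temp(ψ)`,
evaluated at `S` and composed with the unit of the chart) — the edge twin of abc-iut-L3's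
`IsVerticialHom.exists_equiv`. [cite: MochizukiSemiAnbd2006, Thm 3.7(iii) p.41] -/
theorem IsEdgeHom.exists_equiv {c : TemperedPiChart 𝒢} {e : 𝒢.graph.Edge}
    {ψ : 𝒢.Ge e →ₜ* c.G} (hψ : IsEdgeHom c e ψ) (S : BTempCat 𝒢) :
    ∃ ε : (S.obj.SE e).obj.V ≃ (c.equiv.functor.obj S).obj.V,
      ∀ (γ : 𝒢.Ge e) (s : (S.obj.SE e).obj.V),
        ε ((S.obj.SE e).obj.ρ γ s) = (c.equiv.functor.obj S).obj.ρ (ψ γ) (ε s) := by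
  obtain ⟨η⟩ := hψ
  exact BTemp.exists_equiv_of_iso_res ψ
    ((ObjectProperty.ι _ ⋙ restrictE 𝒢 e).mapIso (c.equiv.unitIso.app S) ≪≫
      η.app (c.equiv.functor.obj S))

/-- Membership in `edgeLikeSubgroups` as the range of an edge homomorphism (definitional unfolding).
[cite: MochizukiSemiAnbd2006, Thm 3.7(iii) p.41] -/
theorem mem_edgeLikeSubgroups_iff_exists_isEdgeHom (c : TemperedPiChart 𝒢) (e : 𝒢.graph.Edge)
    (L : Subgroup c.G) :
    L ∈ edgeLikeSubgroups c e ↔ ∃ ψ : 𝒢.Ge e →ₜ* c.G, IsEdgeHom c e ψ ∧ L = ψ.toMonoidHom.range :=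
  Iff.rfl

/-- Membership in `verticialSubgroups` as the range of a verticial homomorphism (definitional unfolding).
[cite: MochizukiSemiAnbd2006, Thm 3.7(i) p.40] -/
theorem mem_verticialSubgroups_iff_exists_isVerticialHom (c : TemperedPiChart 𝒢) (v : 𝒢.graph.Vertex)
    (V : Subgroup c.G) :
    V ∈ verticialSubgroups c v ↔ ∃ ψ : 𝒢.Gv v →ₜ* c.G, IsVerticialHom c v ψ ∧ V = ψ.toMonoidHom.range :=
  Iff.rfl

/-! ### 3. The kernel of the chart image of a finite tempered covering -/

namespace TemperedPiChart

/-- **The finite quotient of `π₁^temp(𝒢)` cut out by a tempered covering with a finite vertex fibre.**  Let `S` be a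
tempered covering of `𝒢` and `ψ₀ : Π_{v₀} → c.G` a verticial homomorphism with `S_{v₀}` finite.  Then the chart
image `c(S)` is finite (`≅ S_{v₀}`), its kernel `U_S ⊴ π₁^temp(𝒢) = c.G` is open, normal, of finite index, and for
every verticial homomorphism `ψ_v` (resp. edge homomorphism `ψ_e`): `ψ_v(γ) ∈ U_S ⟺ γ` fixes `S_v` (resp.
`ψ_e(γ) ∈ U_S ⟺ γ` fixes `S_e`) — [SemiAnbd] Prop. 3.6 (iii) with Thm. 3.7 (i), (iii), read in `B^temp(G)`.
[cite: MochizukiSemiAnbd2006, Prop 3.6(iii) p.38] -/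
theorem exists_openNormal_ker_chartImage (c : TemperedPiChart 𝒢) (S : BTempCat 𝒢)
    {v₀ : 𝒢.graph.Vertex} {ψ₀ : 𝒢.Gv v₀ →ₜ* c.G} (hψ₀ : IsVerticialHom c v₀ ψ₀)
    [Finite (S.obj.SV v₀).obj.V] :
    ∃ U : OpenNormalSubgroup c.G, U.toSubgroup.FiniteIndex ∧
      (∀ g : c.G, g ∈ U.toSubgroup ↔ ∀ x, (c.equiv.functor.obj S).obj.ρ g x = x) ∧
      (∀ (v : 𝒢.graph.Vertex) (ψ : 𝒢.Gv v →ₜ* c.G), IsVerticialHom c v ψ →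
        ∀ γ : 𝒢.Gv v, ψ γ ∈ U.toSubgroup ↔ ∀ s, (S.obj.SV v).obj.ρ γ s = s) ∧
      (∀ (e : 𝒢.graph.Edge) (ψ : 𝒢.Ge e →ₜ* c.G), IsEdgeHom c e ψ →
        ∀ γ : 𝒢.Ge e, ψ γ ∈ U.toSubgroup ↔ ∀ s, (S.obj.SE e).obj.ρ γ s = s) := by
  -- the chart image is finite: `S_{v₀} ≃ c(S)`
  obtain ⟨e₀, -⟩ := hψ₀.exists_equiv S
  haveI : Finite (c.equiv.functor.obj S).obj.V := Finite.of_equiv _ e₀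
  obtain ⟨U, hU, hmem⟩ := BTemp.exists_openNormalSubgroup_forall_ρ_eq_iff (c.equiv.functor.obj S)
  refine ⟨U, hU, hmem, fun v ψ hψ γ => ?_, fun e ψ hψ γ => ?_⟩
  · obtain ⟨ε, hε⟩ := hψ.exists_equiv S
    rw [hmem, ← BTemp.forall_ρ_eq_iff_of_equiv ε (hε γ)]
  · obtain ⟨ε, hε⟩ := hψ.exists_equiv S
    rw [hmem, ← BTemp.forall_ρ_eq_iff_of_equiv ε (hε γ)]

/-- **Subgroup currency: ONE finite quotient for all vertices and edges at once.**  For a tempered covering `S`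
with `S_{v₀}` finite at a vertex `v₀` carrying a verticial subgroup, there is an open normal finite-index
`U ⊴ π₁^temp(𝒢)` with `V ≤ U ⟺ Π_w` fixes `S_w` for every verticial `V` at any `w`, and `L ≤ U ⟺ Π_e` fixes
`S_e` for every edge-like `L` at any `e`. [cite: MochizukiSemiAnbd2006, Thm 3.7(iii) p.41] -/
theorem exists_openNormal_of_covering (c : TemperedPiChart 𝒢) (S : BTempCat 𝒢) {v₀ : 𝒢.graph.Vertex}
    (hne : (verticialSubgroups c v₀).Nonempty) [Finite (S.obj.SV v₀).obj.V] :
    ∃ U : OpenNormalSubgroup c.G, U.toSubgroup.FiniteIndex ∧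
      (∀ (w : 𝒢.graph.Vertex), ∀ V ∈ verticialSubgroups c w,
        V ≤ U.toSubgroup ↔ ∀ (γ : 𝒢.Gv w) (s : (S.obj.SV w).obj.V), (S.obj.SV w).obj.ρ γ s = s) ∧
      (∀ (e : 𝒢.graph.Edge), ∀ L ∈ edgeLikeSubgroups c e,
        L ≤ U.toSubgroup ↔ ∀ (γ : 𝒢.Ge e) (s : (S.obj.SE e).obj.V), (S.obj.SE e).obj.ρ γ s = s) := by
  obtain ⟨V₀, ψ₀, hψ₀, -⟩ := hne
  obtain ⟨U, hU, -, hV, hE⟩ := exists_openNormal_ker_chartImage c S hψ₀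
  refine ⟨U, hU, fun w V hV' => ?_, fun e L hL => ?_⟩
  · obtain ⟨ψ, hψ, rfl⟩ := hV'
    constructor
    · intro hle γ
      exact (hV w ψ hψ γ).1 (hle ⟨γ, rfl⟩)
    · rintro hfix _ ⟨γ, rfl⟩
      exact (hV w ψ hψ γ).2 (hfix γ)
  · obtain ⟨ψ, hψ, rfl⟩ := hL
    constructor
    · intro hle γ
      exact (hE e ψ hψ γ).1 (hle ⟨γ, rfl⟩)
    · rintro hfix _ ⟨γ, rfl⟩
      exact (hE e ψ hψ γ).2 (hfix γ)

/-- **SEPARATION from ONE covering.**  If a tempered covering `S` has `S_v` finite and FIXED by `Π_v` while `Π_e`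
MOVES `S_e`, then some open normal finite-index `U ⊴ π₁^temp(𝒢)` contains every verticial subgroup at `v` and
contains NO edge-like subgroup at `e` — a finite quotient of `π₁^temp(𝒢)` killing `π̂₁(G_v)` and not `π̂₁(G_e)`.
[cite: MochizukiSemiAnbd2006, Thm 3.7(iii) p.41] -/
theorem exists_openNormal_separating_of_covering (c : TemperedPiChart 𝒢) (S : BTempCat 𝒢)
    {v : 𝒢.graph.Vertex} [Finite (S.obj.SV v).obj.V]
    (hfix : ∀ (γ : 𝒢.Gv v) (s : (S.obj.SV v).obj.V), (S.obj.SV v).obj.ρ γ s = s)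
    {e : 𝒢.graph.Edge} (hmove : ∃ (γ : 𝒢.Ge e) (s : (S.obj.SE e).obj.V), (S.obj.SE e).obj.ρ γ s ≠ s)
    {T : Subgroup c.G} (hT : T ∈ verticialSubgroups c v) :
    ∃ U : OpenNormalSubgroup c.G, U.toSubgroup.FiniteIndex ∧ T ≤ U.toSubgroup ∧
      ∀ L ∈ edgeLikeSubgroups c e, ¬ L ≤ U.toSubgroup := by
  obtain ⟨U, hU, hV, hE⟩ := exists_openNormal_of_covering c S ⟨T, hT⟩
  refine ⟨U, hU, (hV v T hT).2 hfix, fun L hL hle => ?_⟩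
  obtain ⟨γ, s, hs⟩ := hmove
  exact hs ((hE e L hL).1 hle γ s)

/-- **The same for the decomposition subgroups `Π^tp_{{v}}` of the edgeless single-vertex sub-semi-graph
`⟨{v}, ∅⟩`** ([IUTchI] §2 p. 44), which ARE the verticial subgroups at `v` for `𝒢` quasi-coherent and
Galois-countable (abc-iut-L3-t6's `decompSubgroups_singleVertex_eq`). [cite: Mochizuki2012, IUTchI §2 p.44] -/
theorem exists_openNormal_separating_decomp_singleVertex_of_covering (hqc : 𝒢.IsQuasiCoherent)
    (hgc : 𝒢.IsGaloisCountable) (c : TemperedPiChart 𝒢) (S : BTempCat 𝒢)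
    {v : 𝒢.graph.Vertex} [Finite (S.obj.SV v).obj.V]
    (hfix : ∀ (γ : 𝒢.Gv v) (s : (S.obj.SV v).obj.V), (S.obj.SV v).obj.ρ γ s = s)
    {e : 𝒢.graph.Edge} (hmove : ∃ (γ : 𝒢.Ge e) (s : (S.obj.SE e).obj.V), (S.obj.SE e).obj.ρ γ s ≠ s)
    {D : Subgroup c.G} (hD : D ∈ c.decompSubgroups ⟨{v}, ∅⟩) :
    ∃ U : OpenNormalSubgroup c.G, U.toSubgroup.FiniteIndex ∧ D ≤ U.toSubgroup ∧
      ∀ L ∈ edgeLikeSubgroups c e, ¬ L ≤ U.toSubgroup :=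
  exists_openNormal_separating_of_covering c S hfix hmove
    ((decompSubgroups_singleVertex_eq hqc hgc c v).symm ▸ hD : D ∈ verticialSubgroups c v)

/-! ### 4. The tempered-level separation binder at `ℍ = ⟨{v}, ∅⟩`, from covering data -/

/-- **The separation binder `hsep` (shape of abc-iut-w4-d070's `hatEdgeIncidence_of_openNormalSeparating`,
p498282) at the single-vertex sub-semi-graph `ℍ := ⟨{v}, ∅⟩ DISCHARGED FROM COVERINGS**: if for every edge `e` no
branch of which abuts `v` there is a tempered covering `S` with `S_v` finite and fixed by `Π_v` and `S_e` moved by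
`Π_e`, then for every such `e`, every edge-like `L` at `e` and any `Π^tp_ℍ := TpH ∈ decompSubgroups c ⟨{v}, ∅⟩`,
some open normal finite-index `U ⊴ π₁^temp(𝒢)` has `TpH ≤ U` and `¬ L ≤ U`.
[cite: MochizukiSemiAnbd2006, Prop 3.6(iii) p.38] -/
theorem openNormalSeparating_singleVertex_of_coverings (hqc : 𝒢.IsQuasiCoherent)
    (hgc : 𝒢.IsGaloisCountable) (c : TemperedPiChart 𝒢) (v : 𝒢.graph.Vertex) (TpH : Subgroup c.G)
    (hTpH : TpH ∈ c.decompSubgroups ⟨{v}, ∅⟩)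
    (hcov : ∀ e : 𝒢.graph.Edge,
      (¬ ∃ b : 𝒢.graph.Branch, 𝒢.graph.edgeOf b = e ∧
          ∃ w ∈ (⟨{v}, ∅⟩ : 𝒢.graph.Subgraph).verts, 𝒢.graph.abuts b = some w) →
      ∃ S : BTempCat 𝒢, Finite (S.obj.SV v).obj.V ∧
        (∀ (γ : 𝒢.Gv v) (s : (S.obj.SV v).obj.V), (S.obj.SV v).obj.ρ γ s = s) ∧
        ∃ (γ : 𝒢.Ge e) (s : (S.obj.SE e).obj.V), (S.obj.SE e).obj.ρ γ s ≠ s) :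
    ∀ e : 𝒢.graph.Edge,
      (¬ ∃ b : 𝒢.graph.Branch, 𝒢.graph.edgeOf b = e ∧
          ∃ w ∈ (⟨{v}, ∅⟩ : 𝒢.graph.Subgraph).verts, 𝒢.graph.abuts b = some w) →
      ∀ L ∈ edgeLikeSubgroups c e, ∃ U : OpenNormalSubgroup c.G,
        U.toSubgroup.FiniteIndex ∧ TpH ≤ U.toSubgroup ∧ ¬ L ≤ U.toSubgroup := by
  intro e he L hL
  obtain ⟨S, hfin, hfix, hmove⟩ := hcov e he
  haveI := hfin
  obtain ⟨U, hU, hT, hLU⟩ :=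
    exists_openNormal_separating_decomp_singleVertex_of_covering hqc hgc c S hfix hmove hTpH
  exact ⟨U, hU, hT, hLU L hL⟩

/-- The same under the hypotheses of [SemiAnbd] Prop. 3.6 (which contain quasi-coherence and
Galois-countability), e.g. at the chart `𝒢.temperedPiChart h36`. [cite: MochizukiSemiAnbd2006, Prop 3.6 p.38] -/
theorem openNormalSeparating_singleVertex_of_coverings_of_prop36 (h36 : 𝒢.Prop36Hypotheses)
    (c : TemperedPiChart 𝒢) (v : 𝒢.graph.Vertex) (TpH : Subgroup c.G)
    (hTpH : TpH ∈ c.decompSubgroups ⟨{v}, ∅⟩)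
    (hcov : ∀ e : 𝒢.graph.Edge,
      (¬ ∃ b : 𝒢.graph.Branch, 𝒢.graph.edgeOf b = e ∧
          ∃ w ∈ (⟨{v}, ∅⟩ : 𝒢.graph.Subgraph).verts, 𝒢.graph.abuts b = some w) →
      ∃ S : BTempCat 𝒢, Finite (S.obj.SV v).obj.V ∧
        (∀ (γ : 𝒢.Gv v) (s : (S.obj.SV v).obj.V), (S.obj.SV v).obj.ρ γ s = s) ∧
        ∃ (γ : 𝒢.Ge e) (s : (S.obj.SE e).obj.V), (S.obj.SE e).obj.ρ γ s ≠ s) :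
    ∀ e : 𝒢.graph.Edge,
      (¬ ∃ b : 𝒢.graph.Branch, 𝒢.graph.edgeOf b = e ∧
          ∃ w ∈ (⟨{v}, ∅⟩ : 𝒢.graph.Subgraph).verts, 𝒢.graph.abuts b = some w) →
      ∀ L ∈ edgeLikeSubgroups c e, ∃ U : OpenNormalSubgroup c.G,
        U.toSubgroup.FiniteIndex ∧ TpH ≤ U.toSubgroup ∧ ¬ L ≤ U.toSubgroup :=
  openNormalSeparating_singleVertex_of_coverings h36.isQuasiCoherent h36.isGaloisCountable c v TpH hTpH hcov

/-- **FINITE-COVERING form** (the consumer's entry point): under the hypotheses of Prop. 3.6 every FINITE object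
of `B^cov(𝒢)` is tempered (abc-iut-L3-t2's `FiniteIsTempered_holds`, Def. 3.5 (ii) p. 37 "`B(G) ↪ B^temp(G)`"),
so the separation binder at `ℍ := ⟨{v}, ∅⟩` follows from: for every edge `e` not abutting `v`, ONE finite
`S : CovObj 𝒢` with `S_v` fixed by `Π_v` and `S_e` moved by `Π_e`. [cite: MochizukiSemiAnbd2006, Def 3.5(ii) p.37] -/
theorem openNormalSeparating_singleVertex_of_finiteCoverings (h36 : 𝒢.Prop36Hypotheses)
    (c : TemperedPiChart 𝒢) (v : 𝒢.graph.Vertex) (TpH : Subgroup c.G)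
    (hTpH : TpH ∈ c.decompSubgroups ⟨{v}, ∅⟩)
    (hcov : ∀ e : 𝒢.graph.Edge,
      (¬ ∃ b : 𝒢.graph.Branch, 𝒢.graph.edgeOf b = e ∧
          ∃ w ∈ (⟨{v}, ∅⟩ : 𝒢.graph.Subgraph).verts, 𝒢.graph.abuts b = some w) →
      ∃ S : CovObj 𝒢, S.IsFinite ∧
        (∀ (γ : 𝒢.Gv v) (s : (S.SV v).obj.V), (S.SV v).obj.ρ γ s = s) ∧
        ∃ (γ : 𝒢.Ge e) (s : (S.SE e).obj.V), (S.SE e).obj.ρ γ s ≠ s) :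
    ∀ e : 𝒢.graph.Edge,
      (¬ ∃ b : 𝒢.graph.Branch, 𝒢.graph.edgeOf b = e ∧
          ∃ w ∈ (⟨{v}, ∅⟩ : 𝒢.graph.Subgraph).verts, 𝒢.graph.abuts b = some w) →
      ∀ L ∈ edgeLikeSubgroups c e, ∃ U : OpenNormalSubgroup c.G,
        U.toSubgroup.FiniteIndex ∧ TpH ≤ U.toSubgroup ∧ ¬ L ≤ U.toSubgroup := by
  refine openNormalSeparating_singleVertex_of_coverings_of_prop36 h36 c v TpH hTpH fun e he => ?_
  obtain ⟨S, hS, hfix, hmove⟩ := hcov e he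
  exact ⟨⟨S, FiniteIsTempered_holds 𝒢 h36.isConnected h36.isCountable S hS⟩, hS.finite_V v, hfix, hmove⟩

end TemperedPiChart

end ProfiniteSemiGraph

end Literature.AnabelianGeometry.SemiGraphs
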